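import Mathlib
import Summits.AtomisticToContinuum.Crystallization.Theses.PoissonBesselStacking
import Summits.AtomisticToContinuum.Crystallization.Theorems.PricedLinkCensusStackingHingeBarlowEnergyIdentification
import Summits.AtomisticToContinuum.Crystallization.Theorems.MinMeanCycleStackingLockLockedBoxMinimiserLayerSums
import Summits.AtomisticToContinuum.Crystallization.Theorems.MinMeanCycleStackingLockLockedBoxMinimiser
import Literature.MathematicalPhysics.StatisticalMechanics.BarlowStackingEnergy
import Literature.MathematicalPhysics.StatisticalMechanics.PeriodicConfigurationSums

/-!
# Route PricedLinkCensus — the relaxed hcp energy attains its minimum on the box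
(stub `stub_hcpEnergyMinOnBox` of line Sketch, stmt-AtomisticToContinuum-14993;
= item stmt-AtomisticToContinuum-3066 `PoissonBesselStacking.HcpEnergyMinOnBox`)

The function `(a, h) ↦ e_LJ(hcp a h) = (hcpPeriodicConfiguration ha hh).energyPerParticle lennardJones`
attains its minimum over the compact box `B = {47/50 ≤ a ≤ 1, 39/50·a ≤ h ≤ 17/20·a}`.

Proof.  For `a, h > 0` the landed layer identification
(`PricedHcpWindowsBarlowEnergy.stub_barlowEnergyIdentification`, item 3065) with the `2`-periodic
alternating Hägg sequence and `haggEnergy_alternating` give the proof-independent closed form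
`e_LJ(hcp a h) = barlowBaseEnergy lennardJones a h + ∑'_{k ≥ 2 even} barlowCoupling lennardJones a h k`.
On the quadrant `a ≥ 47/50`, `h ≥ 1833/2500` (which contains `B`) the first summand is continuous
(`LockedBoxMinimiser.continuousOn_barlowBaseEnergy`, Weierstrass M-test for the layer sums) and so
is the second (each coupling is continuous, `LockedBoxMinimiser.continuousOn_barlowCoupling`, with
the uniform summable majorant `LockedBoxMinimiser.exists_bound_barlowCoupling`; `continuousOn_tsum`).
`B` is compact and non-empty (`(1, 4/5) ∈ B`), so the minimum is attained
(`IsCompact.exists_isMinOn`); points of `B` have positive coordinates.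

All `[folklore]`; no definitions are introduced.
-/

noncomputable section

open Literature.MathematicalPhysics.StatisticalMechanics
open Summit.AtomisticToContinuum.Crystallization.Theorems.LockedBoxMinimiser
open Summit.AtomisticToContinuum.Crystallization.Theses.PoissonBesselStacking (HcpEnergyMinOnBox)

namespace Summit.AtomisticToContinuum.Crystallization.Theorems.PricedHcpWindowsHcpBox

/-- **Closed form of the hcp energy per particle** (`a, h > 0`, any proofs `ha`, `hh`):
`e_LJ(hcp a h) = e₀(a, h) + ∑'_{k ≥ 2 even} J_k(a, h)` with `e₀ = barlowBaseEnergy lennardJones a h`,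
`J = barlowCoupling lennardJones a h` (layer identification for the `2`-periodic alternating
stacking, `haggEnergy_alternating`). [folklore] -/
theorem energyPerParticle_hcp_eq {a h : ℝ} (ha0 : 0 < a) (hh0 : 0 < h) (ha : a ≠ 0) (hh : h ≠ 0) :
    (hcpPeriodicConfiguration ha hh).energyPerParticle lennardJones =
      barlowBaseEnergy lennardJones a h +
        ∑' k : ℕ, (if 2 ≤ k ∧ Even k then barlowCoupling lennardJones a h k else 0) := by
  have h1 := PricedHcpWindowsBarlowEnergy.stub_barlowEnergyIdentification a h ha0 hh0
    alternatingHagg 2 ha hh two_ne_zero alternatingHagg_periodic isHaggSeq_alternating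
  rw [hcpPeriodicConfiguration, h1, haggEnergy_alternating]
  push_cast
  ring

/-- **The even coupling sum `∑'_{k ≥ 2 even} J_k(a, h)` is continuous in `(a, h)`** on every
quadrant `a ≥ a₁ > 0`, `h ≥ h₁ > 0` (Weierstrass M-test with the uniform summable majorant of the
couplings). [folklore] -/
theorem continuousOn_tsum_even_barlowCoupling {a₁ h₁ : ℝ} (ha₁ : 0 < a₁) (hh₁ : 0 < h₁) :
    ContinuousOn (fun p : ℝ × ℝ =>
      ∑' k : ℕ, (if 2 ≤ k ∧ Even k then barlowCoupling lennardJones p.1 p.2 k else 0))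
      (Set.Ici a₁ ×ˢ Set.Ici h₁) := by
  obtain ⟨u, hu, hb⟩ := exists_bound_barlowCoupling ha₁ hh₁
  -- the majorant, re-indexed by the layer distance `k` itself (the term `k = 0` vanishes)
  obtain ⟨v, hv0, hv1⟩ : ∃ v : ℕ → ℝ, v 0 = 0 ∧ ∀ n, v (n + 1) = u n :=
    ⟨fun k => if k = 0 then 0 else u (k - 1), by simp, fun n => by simp⟩
  have hvs : Summable v := by
    rw [← summable_nat_add_iff 1]
    exact hu.congr fun n => (hv1 n).symm
  refine continuousOn_tsum (u := v) (fun k => ?_) hvs ?_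
  · by_cases hk : 2 ≤ k ∧ Even k
    · simp only [if_pos hk]
      exact continuousOn_barlowCoupling ha₁ hh₁ (by have := hk.1; omega)
    · simp only [if_neg hk]
      exact continuousOn_const
  · intro k p hp
    obtain _ | n := k
    · rw [if_neg (fun hk => absurd hk.1 (by norm_num)), norm_zero, hv0]
    · rw [hv1]
      split_ifs
      · rw [Real.norm_eq_abs]
        exact hb n p hp
      · rw [norm_zero]
        exact (abs_nonneg _).trans (hb n p hp)

/-- **The closed form `e₀ + ∑'_{k ≥ 2 even} J_k` of the hcp energy is continuous in `(a, h)`** on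
every quadrant `a ≥ a₁ > 0`, `h ≥ h₁ > 0`. [folklore] -/
theorem continuousOn_hcpEnergy {a₁ h₁ : ℝ} (ha₁ : 0 < a₁) (hh₁ : 0 < h₁) :
    ContinuousOn (fun p : ℝ × ℝ => barlowBaseEnergy lennardJones p.1 p.2 +
      ∑' k : ℕ, (if 2 ≤ k ∧ Even k then barlowCoupling lennardJones p.1 p.2 k else 0))
      (Set.Ici a₁ ×ˢ Set.Ici h₁) :=
  (continuousOn_barlowBaseEnergy ha₁ hh₁).add (continuousOn_tsum_even_barlowCoupling ha₁ hh₁)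

/-- **Item stmt-AtomisticToContinuum-3066** (`PoissonBesselStacking.HcpEnergyMinOnBox`; stub
`stub_hcpEnergyMinOnBox` of line Sketch of the crux `PricedLinkCensus.StackingHinge`): the
Lennard-Jones energy per particle of relaxed hcp, `(a, h) ↦ e_LJ(hcpPeriodicConfiguration a h)`,
attains its minimum over the box `B = {47/50 ≤ a ≤ 1, 39/50·a ≤ h ≤ 17/20·a}` at some
`(a₀, h₀) ∈ B` (continuity of the closed form on a quadrant containing `B`, compactness of `B`).
[folklore] -/
theorem stub_hcpEnergyMinOnBox : Summit.AtomisticToContinuum.Crystallization.Theses.PoissonBesselStacking.HcpEnergyMinOnBox := by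
  have hq₁ : (0 : ℝ) < 47 / 50 := by norm_num
  have hq₂ : (0 : ℝ) < 1833 / 2500 := by norm_num
  have hne : ((1 : ℝ), (4 / 5 : ℝ)) ∈
      {p : ℝ × ℝ | 47 / 50 ≤ p.1 ∧ p.1 ≤ 1 ∧ 39 / 50 * p.1 ≤ p.2 ∧ p.2 ≤ 17 / 20 * p.1} := by
    simp only [Set.mem_setOf_eq]
    norm_num
  obtain ⟨pm, hpm, hmin⟩ := isCompact_box.exists_isMinOn ⟨_, hne⟩
    ((continuousOn_hcpEnergy hq₁ hq₂).mono box_subset_quad)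
  have hpos : 0 < pm.1 ∧ 0 < pm.2 := pos_of_mem_box hpm
  unfold HcpEnergyMinOnBox
  refine ⟨pm.1, pm.2, hpos.1.ne', hpos.2.ne', hpm.1, hpm.2.1, hpm.2.2.1, hpm.2.2.2, ?_⟩
  intro a h ha hh h1 h2 h3 h4
  have hb : ((a, h) : ℝ × ℝ) ∈
      {p : ℝ × ℝ | 47 / 50 ≤ p.1 ∧ p.1 ≤ 1 ∧ 39 / 50 * p.1 ≤ p.2 ∧ p.2 ≤ 17 / 20 * p.1} :=
    ⟨h1, h2, h3, h4⟩
  have hpos' : 0 < a ∧ 0 < h := pos_of_mem_box hb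
  rw [energyPerParticle_hcp_eq hpos.1 hpos.2, energyPerParticle_hcp_eq hpos'.1 hpos'.2]
  exact (isMinOn_iff.1 hmin) (a, h) hb

end Summit.AtomisticToContinuum.Crystallization.Theorems.PricedHcpWindowsHcpBox

end
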